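import Summits.SmoothPoincare4.SmoothPoincare4.Theses.ConvexBisection
import Literature.Topology.FourManifolds.CerfGammaFourProofs
import Literature.Topology.FourManifolds.HomotopyS4CompactProofs
import HarnessLib

/-!
# Line `one-cap-two-fillings` — skeleton for crux `ConvexBisection.PlanarBisectionRigidity`
(item stmt-SmoothPoincare4-10511, route `route-SmoothPoincare4-ConvexBisection`, rank 5)

Crux-plan (planner-cruxplan-stmt-SmoothPoincare4-10511-one-cap-two-fillings-0, 2026-08-16) of the idea card
`Cruxes/PlanarBisectionRigidity/Ideas/one-cap-two-fillings.md` (ideator 3, round 1; triage r1-1/2/3: pass ×3),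
reshaped by the three triage notes:

* ONE CAP FOR BOTH HALVES. In a planar common-contact Stein bisection `M = e₁(W₁) ∪ e₂(W₂)` of a homotopy
  4-sphere the seam `(Γ, ξ)` carries a planar supporting open book `ob` (binding `B = B₁ ⊔ … ⊔ B_k`, pages
  `P_k`). Etnyre's cap `C = C(ob)` (arXiv:math/0404267, proof of Thm 4.1, p. 9: `k` two-handles on the binding
  with PAGE FRAMING, then `S² × D²`; dually `C = S² × D² ∪` `k` two-handles along the closed monodromy braid)
  depends on `ob` alone, so it caps BOTH halves: `Zᵢ = Wᵢ ∪_Γ C`. The cap is TYPED here (`IsPlanarCap`,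
  `Capping`) — non-junkably: the `k` handles `𝔻² × 𝔻²` are co-attached EXACTLY along the binding tubes of `ob`
  (core = binding, product structure = page framing) and the rest of `C` is a smooth `𝕊² × 𝔻²` whose boundary
  spheres meet `∂C` page by page. This is the delta over the sibling line `AcyclicBisectionRigidity/Lines/
  sparse-arrangement-cap` (same lever, cap kept inside a proof, residual = open-book-symmetric doubles).
* `stub_commonCap` (KNOWN modulo vendoring; Etnyre's construction + Wendl arXiv:0806.3193 Thm 1 over the GIVEN
  planar open book for both halves + genus-0 Lefschetz fibrations over `S²` with `k − 1` reducible fibres are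
  `CP² # k CP²-bar` (`k ≥ 2`; `k = 1`: `Wᵢ = B⁴`) — equivalently McDuff 1990 on `(Zᵢ, F)`): a planar supporting
  open book WITH a cap exists, both cappings `Z₁ = W₁ ∪_Γ C`, `Z₂ = W₂ ∪_ψ C` exist as closed smooth
  4-manifolds, and `Z₁ ≅ Z₂`.
* `stub_capUniqueness` / `stub_capUniquenessTorsion` — the card's (U) CAP-CONFIGURATION UNIQUENESS, the LEVER
  (NEW; contractible halves / non-contractible halves): the abstract diffeomorphism `Z₁ ≅ Z₂` can be chosen to
  PRESERVE THE COMMON CAP — `Θ ∘ κ₁ = κ₂ ∘ χ̂` for a cap automorphism `χ̂ ∈ Diff(C)` — hence restricts to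
  `F : W₁ ≅ W₂` whose seam mismatch `χ = ψ⁻¹ ∘ F|∂` EXTENDS OVER THE CAP (as `χ̂`) and is a contactomorphism.
  Engine: `Wᵢ = R_k ∖ ν(Q)` for two symplectic embeddings of ONE configuration `Q = F ∪ S₁ ∪ … ∪ S_k` (capped
  page + `k` braided section spheres; triage r1-2 addendum: the `Sᵢ` are NOT pairwise disjoint in general,
  the invariant data are `(Sᵢ − S_l)² = −#{j : a_j separates i, l}`) in the rational surface `R_k`; homological
  step (Lisca / Golla–Starkston arXiv:1907.06787 §3: `H₂(C) ↪ H₂(R_k) = I_{1,k}` has full rank and index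
  `|H₁(Wᵢ)|`, an ISOMETRY ONTO when `H₁(Wᵢ; ℤ) = 0` — automatic in the contractible sector, a finite check per
  type in the torsion sector: triage r1-2 (S1)'s 19 pairs at `k = 5` with `O = ½(J − 2·antidiag)`), then
  geometric uniqueness by `J`-holomorphic rulings (McDuff), blow-down to `k` low-degree curves in `CP²`
  (Golla–Starkston Thm 1.5: unique for `≤ 5` lines / conic + `≤ 3` lines; Starkston arXiv:1709.02544).
  NOT SPC4-implied: refutable by ONE planar contact seam with two non-diffeomorphic ℚ-acyclic Stein fillings in
  the homotopy-sphere pattern (Akbulut–Yildiz arXiv:1901.00806 / HMP arXiv:1908.05269 pairs IF contactomorphic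
  AND planar; sibling Disproof §6), or by a failed lattice check in the torsion sector.
* `stub_capTwistedDouble` / `stub_capTwistedDoubleTorsion` — the card's (T) ∧ (T″) CAP-TWISTED PLANAR DOUBLES
  (RESIDUAL; contractible body = `ContactTwistedPlanarDouble` of FirstLemmasIdeator3 + cap-extendability, the
  `W₁ = W₂` planar slice of crux `ContractibleTwistedDoubleStandard` (3546) — PROVED below from that crux,
  `capTwistedDouble_of_crux4`; non-contractible ℚHB body = triage's (T″), inhabited by the round `S⁴ =
  X_L ∪_ψ X̄_L` along `S³/Q₈` (sibling Disproof §5b, triage r1-2 (S1): planar) and known there by Price 1977 /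
  Kim–Miller arXiv:1805.00429 §3.1): a homotopy 4-sphere that is `W ∪_χ W̄` for ONE planar Stein body `W`, a
  CONTACTOMORPHISM `χ` of `(∂W, ξ)` that EXTENDS OVER THE CAP `C(ob)`, is `S⁴`. SPC4-implied (shape
  `∀ M ≃ₕ S⁴, P M → M ≅ S⁴`), hence provable only; at `χ = id`, `W` contractible, it contains the planar
  presentation spheres (`PlanarSteinDoubleStandard`, AC-complete up to framings by triage F1/(S2)) — the corner
  EVERY line on this crux bottoms out in.
* Compositions (kernel-checked, no `sorry` of their own): `seamMismatch_of_capping` (pure logic: the cap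
  equations force `e₂ ∘ F ∘ b.incl = e₁ ∘ b.incl ∘ χ`), `seamPlanes_comp_diffeomorph` (chain rule, as in the
  sibling line minimal-factorisation-rigidity), `PlanarBisectionRigidity_of : PlanarBisectionRigidity` BY NAME;
  cross-links `capTwistedDouble_of_crux4`, `planarCapTwins_of_stubs` (the falsifiable shadow `W₁ ≅ W₂`).

Disproof.lean (cdisprove v5 for this crux; its evidence path is not mounted in planner jails, content taken
from the item's evidence notes v1–v5 and from the sibling `Cruxes/AcyclicBisectionRigidity/Disproof.lean`
in the tree) honoured: `of_smoothPoincare4` — only the two residual stubs have the shielded shape; the lever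
stubs conclude diffeomorphisms of HALVES/CAPPINGS and are refutable by computation. `WithoutHomotopyEquiv`
(false: `S¹ × S³ = D(S¹ × D³)`, annulus book) — every stub concluding `≅ S⁴` keeps `M ≃ₕ S⁴`.
`WithoutPlanar ∧ SteinBisectionExists ⇒ SPC4` — planarity is used at `stub_commonCap` (no cap without a planar
book). `HalvesAreBalls` false (Akbulut-cork double, KOU planar structure) — no stub concludes a half is a ball;
§7 census (8 + 64 certified Hurwitz-inequivalent contractible pairs; all doubles AC-trivial) — the lever
identifies Hurwitz-INEQUIVALENT factorisations all the same (the configuration forgets the factorisation), the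
residual is fed `χ`-twisted doubles, not doubles. Sibling §5b (`S³/Q₈` rational contact cork: `ψ` moves
`ker(H₁∂ → H₁X_L)`, extends over NO self-map of `X_L`) — no stub asks `χ` to extend over `W`; cap-extendability
is the replacement, and that instance sits in `stub_capUniquenessTorsion` / `stub_capTwistedDoubleTorsion`.
Landed `Negative/` lemmas for this crux: none (`ledger crux ls`, 2026-08-16); negatives index: 0.
-/

noncomputable section

open scoped Manifold ContDiff Topology ContinuousMap
open Set Function
open Literature.Geometry.Symplectic Literature.Topology.FourManifolds

-- namespace prescribed by the crux protocol (`Summit.<P>.<Sub>.Cruxes.<Crux>.<Slug>`, P = Sub)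
set_option linter.dupNamespace false
set_option linter.unusedVariables false

namespace Summit.SmoothPoincare4.SmoothPoincare4.Cruxes.PlanarBisectionRigidity.OneCapTwoFillings

open Summit.SmoothPoincare4.SmoothPoincare4.Theses.ConvexBisection

/-- Local notation: `𝔼 n = ℝⁿ` (model vector space). -/
local notation "𝔼 " n:arg => EuclideanSpace ℝ (Fin n)
/-- Local notation: the unit sphere `𝕊ⁿ ⊂ ℝⁿ⁺¹`. -/
local notation "𝕊 " n:arg => (Metric.sphere (0 : EuclideanSpace ℝ (Fin (n + 1))) 1)
/-- Local notation: the closed unit ball `𝔻ⁿ ⊂ ℝⁿ` (a manifold with boundary, `ClosedBall.lean`). -/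
local notation "𝔻 " n:arg => (Metric.closedBall (0 : EuclideanSpace ℝ (Fin n)) 1)
/-- Local notation: the round 4-sphere. -/
local notation "𝕊⁴" => (Metric.sphere (0 : EuclideanSpace ℝ (Fin 5)) 1)

/-! ## The typed cap -/

/-- A point of the unit circle as a (boundary) point of the closed unit disc. -/
def toDisc (z : 𝕊 1) : 𝔻 2 :=
  ⟨(z : 𝔼 2), Metric.sphere_subset_closedBall z.2⟩

/-- **`IsPlanarCap ob bC j`: the compact 4-manifold `C` (with boundary datum `bC`, identified with the
3-manifold `N` carrying the open book `ob` by `j : ∂C ≅ N`) is an ETNYRE CAP of `ob`** (arXiv:math/0404267,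
proof of Thm 4.1, p. 9, read upside down: `C = S² × D² ∪` `k` two-handles; the binding tubes of `ob` are the
co-attaching regions of the handles, the page framing is their product structure). Clauses: a radius `c > 0`;
`k = ob.k` smoothly embedded, pairwise disjoint handles `H i : 𝔻² × 𝔻² → C` whose face `∂𝔻² × 𝔻²` IS the
closed binding tube of radius `c` — `H i (x, w) = j⁻¹ (ob.tube i (x, c • w))`, so the disc `H i (·, 0)` is
bounded by the `i`-th binding component and its push-offs `H i (·, w)` by the page-framing parallels; a smooth
embedding `G : 𝕊² × 𝔻² → C` (the trivial sphere bundle over the co-core disc of the capped page) covering the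
rest of `C`, overlapping each handle only in the collar `{c' ≤ ‖w‖}` of its inner face `𝔻² × ∂𝔻²` (a radius
`c' > 0`); and PAGE COMPATIBILITY: wherever the sphere `G (𝕊² × {z})`, `z ∈ ∂𝔻²`, meets `∂C`, it lies on the
page of `ob` over `z` (the capped page over `z` is that sphere; its `k` capping discs lie inside the handles).
The overlaps are open collars (no corner conditions are imposed, so the genuine cap satisfies every clause
after the usual corner rounding: `∂(range G)` runs along the pages and dives into the handle collars before
the binding tubes of radius `c`). These clauses determine `C` up to diffeomorphism relative to the open book
(each boundary sphere of `G` meets each handle in one disc, so the handles sit along the CLOSED BRAID traced by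
the holes of the pages — the capped monodromy — with the framing read off the tubes), up to the
`π₁ SO(3) = ℤ/2` Gluck re-gluing of `S² × D²`, which does not change `W ∪ C` for `k ≥ 2` (odd-square sections
exist) and commutes with cap automorphisms. [folklore] -/
def IsPlanarCap {N : Type} [TopologicalSpace N] [ChartedSpace (𝔼 3) N] [IsManifold (𝓡 3) ∞ N]
    (ob : OpenBook N) {C : Type} [TopologicalSpace C] [ChartedSpace (EuclideanHalfSpace 4) C]
    (bC : BoundaryData (𝓡∂ 4) C (𝓡 3)) (j : bC.carrier ≃ₘ⟮𝓡 3, 𝓡 3⟯ N) : Prop :=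
  ∃ (c c' : ℝ) (H : Fin ob.k → (𝔻 2) × (𝔻 2) → C) (G : (𝕊 2) × (𝔻 2) → C),
    0 < c ∧ 0 < c' ∧
    (∀ i, Manifold.IsSmoothEmbedding ((𝓡∂ 2).prod (𝓡∂ 2)) (𝓡∂ 4) ∞ (H i)) ∧
    Pairwise (fun i i' => Disjoint (range (H i)) (range (H i'))) ∧
    (∀ i (x : 𝕊 1) (w : 𝔻 2),
      H i (toDisc x, w) = bC.incl (j.symm (ob.tube i (x, c • (w : 𝔼 2))))) ∧
    Manifold.IsSmoothEmbedding ((𝓡 2).prod (𝓡∂ 2)) (𝓡∂ 4) ∞ G ∧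
    range G ∪ (⋃ i, range (H i)) = univ ∧
    (∀ i (u w : 𝔻 2), H i (u, w) ∈ range G → c' ≤ ‖(w : 𝔼 2)‖) ∧
    (∀ (p : 𝕊 2) (z : 𝕊 1) (y : bC.carrier), G (p, toDisc z) = bC.incl y → j y ∈ ob.page z)

/-- **A common capping of the two halves of a bisection** (`Capping e₁ e₂ b ob`): an Etnyre cap
`(C, bC, j)` of the open book `ob` on the boundary datum `b` of `W₁`, and the two CLOSED smooth 4-manifolds
`Z₁ = W₁ ∪_{∂W₁ ≡ ∂C} C` (glued along `b.incl z ≡ bC.incl (j⁻¹ z)`) and `Z₂ = W₂ ∪_{seam} C` (glued along the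
seam identification read on `b`: `w₂ ≡ bC.incl (j⁻¹ z)` iff `e₂ w₂ = e₁ (b.incl z)`), each given by a pair of
smooth codimension-0 embeddings covering it and meeting exactly along the identified boundaries (the tree's
`IsClosedGluing` / `IsBoundaryGluing`, `Gluing.lean`, unbundled so that later stubs can name the embeddings). -/
structure Capping {M : Type} [TopologicalSpace M] [ChartedSpace (𝔼 4) M]
    {W₁ : Type} [TopologicalSpace W₁] [ChartedSpace (EuclideanHalfSpace 4) W₁]
    {W₂ : Type} [TopologicalSpace W₂] [ChartedSpace (EuclideanHalfSpace 4) W₂]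
    (e₁ : W₁ → M) (e₂ : W₂ → M)
    (b : BoundaryData (𝓡∂ 4) W₁ (𝓡 3)) (ob : OpenBook b.carrier) : Type 1 where
  /-- the cap -/
  C : Type
  [topC : TopologicalSpace C]
  [t2C : T2Space C]
  [scC : SecondCountableTopology C]
  [chartC : ChartedSpace (EuclideanHalfSpace 4) C]
  [manifoldC : IsManifold (𝓡∂ 4) ∞ C]
  [compactC : CompactSpace C]
  /-- its boundary 3-manifold … -/
  bC : BoundaryData (𝓡∂ 4) C (𝓡 3)
  /-- … identified with the boundary 3-manifold of `W₁` carrying the open book -/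
  j : bC.carrier ≃ₘ⟮𝓡 3, 𝓡 3⟯ b.carrier
  /-- `C` is an Etnyre cap of `ob` -/
  isCap : IsPlanarCap ob bC j
  /-- the capping of the first half … -/
  Z₁ : Type
  [topZ₁ : TopologicalSpace Z₁]
  [t2Z₁ : T2Space Z₁]
  [scZ₁ : SecondCountableTopology Z₁]
  [chartZ₁ : ChartedSpace (𝔼 4) Z₁]
  [manifoldZ₁ : IsManifold (𝓡 4) ∞ Z₁]
  [compactZ₁ : CompactSpace Z₁]
  /-- … with its two pieces -/
  ι₁ : W₁ → Z₁
  κ₁ : C → Z₁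
  hι₁ : Manifold.IsSmoothEmbedding (𝓡∂ 4) (𝓡 4) ∞ ι₁
  hκ₁ : Manifold.IsSmoothEmbedding (𝓡∂ 4) (𝓡 4) ∞ κ₁
  cover₁ : range ι₁ ∪ range κ₁ = univ
  glue₁ : ∀ w c, ι₁ w = κ₁ c ↔ ∃ z, w = b.incl z ∧ c = bC.incl (j.symm z)
  /-- the capping of the second half … -/
  Z₂ : Type
  [topZ₂ : TopologicalSpace Z₂]
  [t2Z₂ : T2Space Z₂]
  [scZ₂ : SecondCountableTopology Z₂]
  [chartZ₂ : ChartedSpace (𝔼 4) Z₂]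
  [manifoldZ₂ : IsManifold (𝓡 4) ∞ Z₂]
  [compactZ₂ : CompactSpace Z₂]
  /-- … with its two pieces, glued along the seam identification `ψ = e₂⁻¹ ∘ e₁|∂W₁` read on `b` -/
  ι₂ : W₂ → Z₂
  κ₂ : C → Z₂
  hι₂ : Manifold.IsSmoothEmbedding (𝓡∂ 4) (𝓡 4) ∞ ι₂
  hκ₂ : Manifold.IsSmoothEmbedding (𝓡∂ 4) (𝓡 4) ∞ κ₂
  cover₂ : range ι₂ ∪ range κ₂ = univ
  glue₂ : ∀ w c, ι₂ w = κ₂ c ↔ ∃ z, e₂ w = e₁ (b.incl z) ∧ c = bC.incl (j.symm z)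

attribute [instance] Capping.topC Capping.t2C Capping.scC Capping.chartC Capping.manifoldC
  Capping.compactC Capping.topZ₁ Capping.t2Z₁ Capping.scZ₁ Capping.chartZ₁ Capping.manifoldZ₁
  Capping.compactZ₁ Capping.topZ₂ Capping.t2Z₂ Capping.scZ₂ Capping.chartZ₂ Capping.manifoldZ₂
  Capping.compactZ₂

/-! ## Stub 1 — the common cap (KNOWN modulo vendoring) -/

/-- **Stub 1 · COMMON CAP.** In a common-contact Stein bisection `M = e₁(W₁) ∪ e₂(W₂)` of `M ≃ₕ S⁴` with
`(∂W₁, ξ₁)` planar there are: a boundary datum `b` of `W₁`, a PLANAR open book `ob` on it supporting the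
pulled-back complex tangencies `ξ₁`, a common capping `K : Capping e₁ e₂ b ob` (an Etnyre cap `C` of `ob` and
the closed manifolds `Z₁ = W₁ ∪_Γ C`, `Z₂ = W₂ ∪_ψ C`), and a diffeomorphism `Z₁ ≅ Z₂`.
Why true (known modulo vendoring; size L–XL formally): choose any planar supporting open book without
repeated binding tubes (`PlanarContactBoundary J₁`); Etnyre's construction (arXiv:math/0404267 p. 9) gives `C`
with the clauses of `IsPlanarCap` (handles co-attached along the binding tubes with page framing, then
`S² × D²` whose boundary spheres are the capped pages); gluings exist (`exists_isBoundaryGluing`, Hirsch §8.2;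
for `Z₂` transport `b` across the seam `ψ`, a contactomorphism by the matched complex tangencies, so `ψ(ob)`
supports `ξ₂` and the SAME `C` caps `W₂`); by Wendl (arXiv:0806.3193 Thm 1) each `Wᵢ` is a planar Lefschetz
fibration over the given book with `k − 1` vanishing cycles (ℚ-acyclicity: Etnyre Thm 4.1 + Mayer–Vietoris in
the homology sphere `M`), so `Zᵢ` is a genus-0 Lefschetz fibration over `S²` with `k − 1` reducible fibres
and a section, i.e. `(S²-bundle over S²) # (k−1) CP²-bar ≅ CP² # k CP²-bar` for `k ≥ 2` (for `k = 1`,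
`W₁ ≅ W₂ ≅ B⁴` by Eliashberg and `Z₁ = Z₂`-shaped trivially); equivalently McDuff 1990 applied to the
symplectic sphere `F` of square `0` (Etnyre loc. cit.). Hence `Z₁ ≅ Z₂`. This is the card's free footprint
(cousin of `BindingNumberDissolution`, SPC4-implied, triage r1-1 (iii)/r1-2 (S4)) turned into the input of
the lever. -/
theorem stub_commonCap
    (M : Type) [TopologicalSpace M] [T2Space M] [SecondCountableTopology M] [ChartedSpace (𝔼 4) M]
    [IsManifold (𝓡 4) ∞ M] (hM : M ≃ₕ 𝕊⁴)
    (W₁ : Type) [TopologicalSpace W₁] [ChartedSpace (EuclideanHalfSpace 4) W₁] [IsManifold (𝓡∂ 4) ∞ W₁]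
    [CompactSpace W₁] (W₂ : Type) [TopologicalSpace W₂] [ChartedSpace (EuclideanHalfSpace 4) W₂]
    [IsManifold (𝓡∂ 4) ∞ W₂] [CompactSpace W₂] (J₁ : SteinStructure W₁) (J₂ : SteinStructure W₂)
    (e₁ : W₁ → M) (e₂ : W₂ → M)
    (he₁ : Manifold.IsSmoothEmbedding (𝓡∂ 4) (𝓡 4) ∞ e₁)
    (he₂ : Manifold.IsSmoothEmbedding (𝓡∂ 4) (𝓡 4) ∞ e₂)
    (hcover : range e₁ ∪ range e₂ = univ)
    (hseam₁ : range e₁ ∩ range e₂ = e₁ '' (𝓡∂ 4).boundary W₁)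
    (hseam₂ : range e₁ ∩ range e₂ = e₂ '' (𝓡∂ 4).boundary W₂)
    (hξ : ∀ w₁ w₂, e₁ w₁ = e₂ w₂ →
      Submodule.map (mfderiv (𝓡∂ 4) (𝓡 4) e₁ w₁).toLinearMap (contactPlane J₁.J w₁) =
      Submodule.map (mfderiv (𝓡∂ 4) (𝓡 4) e₂ w₂).toLinearMap (contactPlane J₂.J w₂))
    (hpl : PlanarContactBoundary J₁) :
    ∃ (b : BoundaryData (𝓡∂ 4) W₁ (𝓡 3)) (ob : OpenBook b.carrier),
      ob.IsPlanar ∧ ob.Supports (boundaryPlaneField J₁.J b) ∧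
      ∃ K : Capping e₁ e₂ b ob, Nonempty (K.Z₁ ≃ₘ⟮𝓡 4, 𝓡 4⟯ K.Z₂) := by
  sorry

/-! ## Stubs 2a / 2b — cap-configuration uniqueness (the LEVER, NEW) -/

/-- **Stub 2a · CAP-CONFIGURATION UNIQUENESS, contractible halves (the card's (U) in the integral lattice
sector).** Given the bisection, a planar supporting open book `ob` on `b`, a common capping `K` and an abstract
diffeomorphism `Z₁ ≅ Z₂`, if `W₁` is contractible then the diffeomorphism can be chosen CAP-PRESERVING: there
are `Θ : Z₁ ≅ Z₂`, a cap automorphism `χ̂ : C ≅ C`, `F : W₁ ≅ W₂` and `χ : ∂W₁ ≅ ∂W₁` (read on `b`) with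
`Θ ∘ κ₁ = κ₂ ∘ χ̂` (cap to cap), `Θ ∘ ι₁ = ι₂ ∘ F` (half to half), `χ̂|∂C = χ` (through `j`), and `F` a
boundary contactomorphism `DF(ξ₁) = ξ₂` on `∂W₁`. Consequences (pure logic, `seamMismatch_of_capping`): the
seam mismatch of `F` is `χ` and extends over the cap, so `M ≅ W₁ ∪_χ W̄₁` is a CAP-TWISTED DOUBLE.
Why plausibly true: `Wᵢ = Zᵢ ∖ κᵢ(C)°` are the complements of two embeddings of ONE configuration
`Q = F ∪ S₁ ∪ … ∪ S_k ⊂ C` (capped page + `k` braided section spheres, symplectic after the Eliashberg/Gay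
handle model — triage r1-1 (i): Etnyre's `S′` is only topological as printed) in `R_k = CP² # k CP²-bar`, with
`b₂⁺ = 1` and `J`-holomorphic rulings by the class of `F` for EVERY tame `J` (McDuff 1990). Contractible
halves make `H₂(C) → H₂(Zᵢ) = I_{1,k}` an isometry ONTO (index `|H₁(Wᵢ)| = 1`), so the homological step of
Golla–Starkston (arXiv:1907.06787 §3) is automatic (Wall 1964: `Diff(R_k)` realises `O(I_{1,k})` for `k ≤ 9`);
the geometric step is connectedness of the space of `k`-tuples of `J`-sections with the prescribed incidence
braid, i.e. after blowing down `k − 1` exceptional sections a configuration of `k` low-degree rational curves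
through the pencil point in `CP²` — unique for `≤ 5` lines and for conic + `≤ 3` lines (Golla–Starkston
Thm 1.5), isotopic-to-complex for generic line arrangements (Starkston arXiv:1709.02544); research beyond
(Orevkov-type non-uniqueness exists for higher degree; Ruberman–Starkston). The symplectomorphism of `R_k`
carrying `ι₁(Q)` to `ι₂(Q)` is made to carry cap to cap (uniqueness of regular neighbourhoods) and adjusted
in a collar of the seam (Gray stability: both seams are contact-type boundaries of neighbourhoods of `Q`) so
that `F|∂` is a contactomorphism on the nose. NOT implied by SPC4 (it outputs a diffeomorphism of the HALVES):
refutable by one planar contact seam with two non-diffeomorphic contractible Stein fillings in the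
homotopy-sphere pattern (Akbulut–Yildiz arXiv:1901.00806 Thm 1 / Hayden–Mark–Piccirillo arXiv:1908.05269
§6.0.1, IF their Stein contact structures are contactomorphic AND planar — sibling Disproof §6), or by a cork
twist `τ` of a planar cork that is a contactomorphism but extends over no cap automorphism modulo
`W`-extendable diffeomorphisms (first test: Ukida's planar PALF of the Akbulut cork, arXiv:1406.5865, KOU
arXiv:1607.07661 Prop 2.3, `k = 5`). Size XL. -/
theorem stub_capUniqueness
    (M : Type) [TopologicalSpace M] [T2Space M] [SecondCountableTopology M] [ChartedSpace (𝔼 4) M]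
    [IsManifold (𝓡 4) ∞ M] (hM : M ≃ₕ 𝕊⁴)
    (W₁ : Type) [TopologicalSpace W₁] [ChartedSpace (EuclideanHalfSpace 4) W₁] [IsManifold (𝓡∂ 4) ∞ W₁]
    [CompactSpace W₁] (W₂ : Type) [TopologicalSpace W₂] [ChartedSpace (EuclideanHalfSpace 4) W₂]
    [IsManifold (𝓡∂ 4) ∞ W₂] [CompactSpace W₂] (J₁ : SteinStructure W₁) (J₂ : SteinStructure W₂)
    (e₁ : W₁ → M) (e₂ : W₂ → M)
    (he₁ : Manifold.IsSmoothEmbedding (𝓡∂ 4) (𝓡 4) ∞ e₁)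
    (he₂ : Manifold.IsSmoothEmbedding (𝓡∂ 4) (𝓡 4) ∞ e₂)
    (hcover : range e₁ ∪ range e₂ = univ)
    (hseam₁ : range e₁ ∩ range e₂ = e₁ '' (𝓡∂ 4).boundary W₁)
    (hseam₂ : range e₁ ∩ range e₂ = e₂ '' (𝓡∂ 4).boundary W₂)
    (hξ : ∀ w₁ w₂, e₁ w₁ = e₂ w₂ →
      Submodule.map (mfderiv (𝓡∂ 4) (𝓡 4) e₁ w₁).toLinearMap (contactPlane J₁.J w₁) =
      Submodule.map (mfderiv (𝓡∂ 4) (𝓡 4) e₂ w₂).toLinearMap (contactPlane J₂.J w₂))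
    (b : BoundaryData (𝓡∂ 4) W₁ (𝓡 3)) (ob : OpenBook b.carrier) (hobpl : ob.IsPlanar)
    (hsup : ob.Supports (boundaryPlaneField J₁.J b))
    (K : Capping e₁ e₂ b ob) (hZ : Nonempty (K.Z₁ ≃ₘ⟮𝓡 4, 𝓡 4⟯ K.Z₂))
    (hW : ContractibleSpace W₁) :
    ∃ (Θ : K.Z₁ ≃ₘ⟮𝓡 4, 𝓡 4⟯ K.Z₂) (χc : K.C ≃ₘ⟮𝓡∂ 4, 𝓡∂ 4⟯ K.C) (F : W₁ ≃ₘ⟮𝓡∂ 4, 𝓡∂ 4⟯ W₂)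
      (χ : b.carrier ≃ₘ⟮𝓡 3, 𝓡 3⟯ b.carrier),
      (∀ c, Θ (K.κ₁ c) = K.κ₂ (χc c)) ∧
      (∀ w, Θ (K.ι₁ w) = K.ι₂ (F w)) ∧
      (∀ x, χc (K.bC.incl x) = K.bC.incl (K.j.symm (χ (K.j x)))) ∧
      (∀ w, w ∈ (𝓡∂ 4).boundary W₁ →
        Submodule.map (mfderiv (𝓡∂ 4) (𝓡∂ 4) F w).toLinearMap (contactPlane J₁.J w) =
          contactPlane J₂.J (F w)) := by
  sorry

/-- **Stub 2b · CAP-CONFIGURATION UNIQUENESS, non-contractible halves (the card's (U) in the torsion /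
perfect-π₁ sector).** Same data and conclusion as Stub 2a with `W₁` NOT contractible (for a ℚ-acyclic Stein
half: `H₁(W₁; ℤ) ≠ 0` finite with `|H₁ W₁|² = |H₁ ∂W₁|`, or `π₁ W₁` perfect ≠ 1). Why filed separately
(triage r1-2 (S1), r1-3 (F2)): this sector is INHABITED — 19 explicit homotopy 4-spheres `Σ(A, B)` at `k = 5`
with ℚHB halves (`π₁ = ℤ/2`) and seam `S³/Q₈ = M(−1; ½, ½, ½)`, and the round `S⁴ = X_L ∪_ψ X̄_L`
(`X_L = N₋₂(ℝP²)`) — and here the lever carries an extra, purely arithmetical load: `H₂(C) ↪ H₂(Zᵢ) =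
I_{1,k}` are FULL-RANK sublattices of index `|H₁(Wᵢ)| > 1`, and a cap-preserving `Θ` exists only if the
rational isometry `ι₂ ∘ h ∘ ι₁⁻¹` is INTEGRAL for some `h ∈ O(H₂ C)` realised by cap automorphisms — for the
19 pairs the hole-set data differ by `O = ½(J − 2·antidiag)` (triage r1-2), so the first job of the line is
this one-page lattice check (kit), then `X_A ≅ X_B` by Kirby calculus on the recorded words. If the check
fails, THIS stub dies alone (no exotic sphere involved), the contractible line 2a + 3 stands, and the sector
reverts to filling classification of the prism seams (Etnyre–Ozbagci–Tosun arXiv:2408.09292 Thm 18/20,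
Rem 21) + Price. Size L–XL; NOT SPC4-implied. -/
theorem stub_capUniquenessTorsion
    (M : Type) [TopologicalSpace M] [T2Space M] [SecondCountableTopology M] [ChartedSpace (𝔼 4) M]
    [IsManifold (𝓡 4) ∞ M] (hM : M ≃ₕ 𝕊⁴)
    (W₁ : Type) [TopologicalSpace W₁] [ChartedSpace (EuclideanHalfSpace 4) W₁] [IsManifold (𝓡∂ 4) ∞ W₁]
    [CompactSpace W₁] (W₂ : Type) [TopologicalSpace W₂] [ChartedSpace (EuclideanHalfSpace 4) W₂]
    [IsManifold (𝓡∂ 4) ∞ W₂] [CompactSpace W₂] (J₁ : SteinStructure W₁) (J₂ : SteinStructure W₂)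
    (e₁ : W₁ → M) (e₂ : W₂ → M)
    (he₁ : Manifold.IsSmoothEmbedding (𝓡∂ 4) (𝓡 4) ∞ e₁)
    (he₂ : Manifold.IsSmoothEmbedding (𝓡∂ 4) (𝓡 4) ∞ e₂)
    (hcover : range e₁ ∪ range e₂ = univ)
    (hseam₁ : range e₁ ∩ range e₂ = e₁ '' (𝓡∂ 4).boundary W₁)
    (hseam₂ : range e₁ ∩ range e₂ = e₂ '' (𝓡∂ 4).boundary W₂)
    (hξ : ∀ w₁ w₂, e₁ w₁ = e₂ w₂ →
      Submodule.map (mfderiv (𝓡∂ 4) (𝓡 4) e₁ w₁).toLinearMap (contactPlane J₁.J w₁) =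
      Submodule.map (mfderiv (𝓡∂ 4) (𝓡 4) e₂ w₂).toLinearMap (contactPlane J₂.J w₂))
    (b : BoundaryData (𝓡∂ 4) W₁ (𝓡 3)) (ob : OpenBook b.carrier) (hobpl : ob.IsPlanar)
    (hsup : ob.Supports (boundaryPlaneField J₁.J b))
    (K : Capping e₁ e₂ b ob) (hZ : Nonempty (K.Z₁ ≃ₘ⟮𝓡 4, 𝓡 4⟯ K.Z₂))
    (hW : ¬ ContractibleSpace W₁) :
    ∃ (Θ : K.Z₁ ≃ₘ⟮𝓡 4, 𝓡 4⟯ K.Z₂) (χc : K.C ≃ₘ⟮𝓡∂ 4, 𝓡∂ 4⟯ K.C) (F : W₁ ≃ₘ⟮𝓡∂ 4, 𝓡∂ 4⟯ W₂)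
      (χ : b.carrier ≃ₘ⟮𝓡 3, 𝓡 3⟯ b.carrier),
      (∀ c, Θ (K.κ₁ c) = K.κ₂ (χc c)) ∧
      (∀ w, Θ (K.ι₁ w) = K.ι₂ (F w)) ∧
      (∀ x, χc (K.bC.incl x) = K.bC.incl (K.j.symm (χ (K.j x)))) ∧
      (∀ w, w ∈ (𝓡∂ 4).boundary W₁ →
        Submodule.map (mfderiv (𝓡∂ 4) (𝓡∂ 4) F w).toLinearMap (contactPlane J₁.J w) =
          contactPlane J₂.J (F w)) := by
  sorry

/-! ## Stubs 3 / 4 — cap-twisted planar doubles are standard (the RESIDUAL) -/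

/-- **Stub 3 · CAP-TWISTED PLANAR DOUBLES, contractible body (the card's (T) = `ContactTwistedPlanarDouble`
+ cap-extendability).** Data: `M ≃ₕ S⁴`; ONE compact contractible Stein domain `(W, J)` with a planar open
book `ob` on a boundary datum `b` supporting `ξ_J`; two smooth embeddings `e₁, e₂ : W → M` covering `M` and
meeting exactly along `e₁(∂W) = e₂(∂W)` with matched complex tangencies; the seam self-gluing is
`χ ∈ Diff(∂W)` (`e₂ ∘ b.incl = e₁ ∘ b.incl ∘ χ`; a contactomorphism of the un-co-oriented `ξ_J` by the
matching); and `χ` EXTENDS OVER AN ETNYRE CAP `C` of `ob` (`χ̂ ∈ Diff(C)`, `χ̂|∂C = χ` through `j`).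
Conclusion: `M ≅ S⁴`. The planar, `W₁ = W₂`, cap-extendable slice of crux `ContractibleTwistedDoubleStandard`
(stmt-SmoothPoincare4-3546) — PROVED from it below (`capTwistedDouble_of_crux4`), so this sector is already
staffed; what the extra hypotheses buy: both cappings `W ∪_id C` and `W ∪_χ C` are the SAME rational surface
with the same configuration (`id_W ∪ χ̂`), `χ` is a cap symmetry (a diffeomorphism of
`S² × D² ∪` handles preserving the handle structure up to isotopy — an open-book symmetry composed with
binding-torus twists and the Gluck `ℤ/2`), so the statement is fed a FINITE census of regluings per `(P_k, φ)`,
not `Cont(∂W, ξ)`. Contains, at `χ = id`, the planar presentation spheres `D(W) = ∂(W × I)`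
(`PlanarSteinDoubleStandard`; by triage r1-3 (F1) = r1-2 (S2) every balanced presentation of the trivial
group has a planar avatar, so this corner is Andrews–Curtis-complete up to framings — all 112 + 128 census
doubles are AC-trivial, Disproof §7); at `χ = τ` the contact cork twists (Gompf arXiv:1603.05090 Q2.2). SPC4-
implied (shape `∀ M ≃ₕ S⁴, P M → M ≅ S⁴`), hence provable only, never refutable; `M ≃ₕ S⁴` is redundant
here (contractible halves) but kept for uniformity with Stub 4. HARDEST stub of the line; size XL /
open-problem. -/
theorem stub_capTwistedDouble
    (M : Type) [TopologicalSpace M] [T2Space M] [SecondCountableTopology M] [ChartedSpace (𝔼 4) M]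
    [IsManifold (𝓡 4) ∞ M] (hM : M ≃ₕ 𝕊⁴)
    (W : Type) [TopologicalSpace W] [ChartedSpace (EuclideanHalfSpace 4) W] [IsManifold (𝓡∂ 4) ∞ W]
    [CompactSpace W] [ContractibleSpace W] (J : SteinStructure W)
    (b : BoundaryData (𝓡∂ 4) W (𝓡 3)) (ob : OpenBook b.carrier) (hobpl : ob.IsPlanar)
    (hsup : ob.Supports (boundaryPlaneField J.J b))
    (e₁ e₂ : W → M)
    (he₁ : Manifold.IsSmoothEmbedding (𝓡∂ 4) (𝓡 4) ∞ e₁)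
    (he₂ : Manifold.IsSmoothEmbedding (𝓡∂ 4) (𝓡 4) ∞ e₂)
    (hcover : range e₁ ∪ range e₂ = univ)
    (hseam₁ : range e₁ ∩ range e₂ = e₁ '' (𝓡∂ 4).boundary W)
    (hseam₂ : range e₁ ∩ range e₂ = e₂ '' (𝓡∂ 4).boundary W)
    (hξ : ∀ w w', e₁ w = e₂ w' →
      Submodule.map (mfderiv (𝓡∂ 4) (𝓡 4) e₁ w).toLinearMap (contactPlane J.J w) =
      Submodule.map (mfderiv (𝓡∂ 4) (𝓡 4) e₂ w').toLinearMap (contactPlane J.J w'))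
    (χ : b.carrier ≃ₘ⟮𝓡 3, 𝓡 3⟯ b.carrier) (hχ : ∀ y, e₂ (b.incl y) = e₁ (b.incl (χ y)))
    (C : Type) [TopologicalSpace C] [T2Space C] [SecondCountableTopology C]
    [ChartedSpace (EuclideanHalfSpace 4) C] [IsManifold (𝓡∂ 4) ∞ C] [CompactSpace C]
    (bC : BoundaryData (𝓡∂ 4) C (𝓡 3)) (j : bC.carrier ≃ₘ⟮𝓡 3, 𝓡 3⟯ b.carrier)
    (hcap : IsPlanarCap ob bC j) (χc : C ≃ₘ⟮𝓡∂ 4, 𝓡∂ 4⟯ C)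
    (hext : ∀ x, χc (bC.incl x) = bC.incl (j.symm (χ (j x)))) :
    Nonempty (M ≃ₘ⟮𝓡 4, 𝓡 4⟯ 𝕊⁴) := by
  sorry

/-- **Stub 4 · CAP-TWISTED PLANAR DOUBLES, non-contractible body (the triage's missing conjunct (T″)).**
Same data as Stub 3 with `W` NOT contractible (a ℚHB / perfect-π₁ planar Stein body; ℚ-acyclicity itself
is a consequence of planarity + `M ≃ₕ S⁴`, Etnyre Thm 4.1 + Mayer–Vietoris, and is not repeated as a
hypothesis). Here `χ` NEVER extends over `W` (`π₁(W ∪_χ W̄) = 1 ≠ π₁ D(W)`), so these are the genuinely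
twisted doubles; `M ≃ₕ S⁴` is load-bearing (`WithoutHomotopyEquiv`: `D(B_{p,q})`-type doubles have
`π₁ ≠ 1`). Inhabited standard instance: `S⁴ = X_L ∪_ψ X̄_L` along `(S³/Q₈, ξ₁)` (Ghiggini–Lisca–Stipsicz
arXiv:math/0509714 §4; planar by triage r1-2 (S1); `ψ` moves `ker(H₁∂ → H₁X_L)`), standard by Price 1977 /
Kim–Miller arXiv:1805.00429 §3.1 (all regluings of `ν(ℝP²) ⊂ S⁴` along `S³/Q₈` are standard). Why plausibly
true: spherical seams with symplectic ℚHB fillings are confined to the prism family (Etnyre–Ozbagci–Tosun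
arXiv:2408.09292 Thm 18/20, Rem 21), cap-extendable contactomorphisms form a finite census per `(P_k, φ)`,
and Price/Gluck-type recognisers close each; first test family = the 19 census pairs of triage r1-2 (is every
planar Stein ℚHB filling of `(M(−1; ½,½,½), ξ)` diffeomorphic to `N₋₂(ℝP²)`?). SPC4-implied, provable only.
Size L. -/
theorem stub_capTwistedDoubleTorsion
    (M : Type) [TopologicalSpace M] [T2Space M] [SecondCountableTopology M] [ChartedSpace (𝔼 4) M]
    [IsManifold (𝓡 4) ∞ M] (hM : M ≃ₕ 𝕊⁴)
    (W : Type) [TopologicalSpace W] [ChartedSpace (EuclideanHalfSpace 4) W] [IsManifold (𝓡∂ 4) ∞ W]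
    [CompactSpace W] (hW : ¬ ContractibleSpace W) (J : SteinStructure W)
    (b : BoundaryData (𝓡∂ 4) W (𝓡 3)) (ob : OpenBook b.carrier) (hobpl : ob.IsPlanar)
    (hsup : ob.Supports (boundaryPlaneField J.J b))
    (e₁ e₂ : W → M)
    (he₁ : Manifold.IsSmoothEmbedding (𝓡∂ 4) (𝓡 4) ∞ e₁)
    (he₂ : Manifold.IsSmoothEmbedding (𝓡∂ 4) (𝓡 4) ∞ e₂)
    (hcover : range e₁ ∪ range e₂ = univ)
    (hseam₁ : range e₁ ∩ range e₂ = e₁ '' (𝓡∂ 4).boundary W)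
    (hseam₂ : range e₁ ∩ range e₂ = e₂ '' (𝓡∂ 4).boundary W)
    (hξ : ∀ w w', e₁ w = e₂ w' →
      Submodule.map (mfderiv (𝓡∂ 4) (𝓡 4) e₁ w).toLinearMap (contactPlane J.J w) =
      Submodule.map (mfderiv (𝓡∂ 4) (𝓡 4) e₂ w').toLinearMap (contactPlane J.J w'))
    (χ : b.carrier ≃ₘ⟮𝓡 3, 𝓡 3⟯ b.carrier) (hχ : ∀ y, e₂ (b.incl y) = e₁ (b.incl (χ y)))
    (C : Type) [TopologicalSpace C] [T2Space C] [SecondCountableTopology C]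
    [ChartedSpace (EuclideanHalfSpace 4) C] [IsManifold (𝓡∂ 4) ∞ C] [CompactSpace C]
    (bC : BoundaryData (𝓡∂ 4) C (𝓡 3)) (j : bC.carrier ≃ₘ⟮𝓡 3, 𝓡 3⟯ b.carrier)
    (hcap : IsPlanarCap ob bC j) (χc : C ≃ₘ⟮𝓡∂ 4, 𝓡∂ 4⟯ C)
    (hext : ∀ x, χc (bC.incl x) = bC.incl (j.symm (χ (j x)))) :
    Nonempty (M ≃ₘ⟮𝓡 4, 𝓡 4⟯ 𝕊⁴) := by
  sorry

/-! ## The composition (kernel-checked; no `sorry` below this line) -/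

/-- **The cap equations force the seam mismatch (pure logic).** For a common capping `K` and diffeomorphisms
`Θ : Z₁ ≅ Z₂`, `χ̂ : C ≅ C`, `F : W₁ ≅ W₂`, `χ : ∂W₁ ≅ ∂W₁` with `Θ ∘ κ₁ = κ₂ ∘ χ̂`, `Θ ∘ ι₁ = ι₂ ∘ F` and
`χ̂|∂C = χ`: the seam mismatch of `F` is `χ`, i.e. `e₂ (F (b.incl y)) = e₁ (b.incl (χ y))` — apply `Θ` to the
gluing equation of `Z₁` at `b.incl y`, read the result through the gluing relation of `Z₂`, and cancel the
injective maps `bC.incl`, `j⁻¹`. [folklore] -/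
theorem seamMismatch_of_capping
    {M : Type} [TopologicalSpace M] [ChartedSpace (𝔼 4) M]
    {W₁ : Type} [TopologicalSpace W₁] [ChartedSpace (EuclideanHalfSpace 4) W₁]
    {W₂ : Type} [TopologicalSpace W₂] [ChartedSpace (EuclideanHalfSpace 4) W₂]
    {e₁ : W₁ → M} {e₂ : W₂ → M} {b : BoundaryData (𝓡∂ 4) W₁ (𝓡 3)} {ob : OpenBook b.carrier}
    (K : Capping e₁ e₂ b ob) (Θ : K.Z₁ ≃ₘ⟮𝓡 4, 𝓡 4⟯ K.Z₂) (χc : K.C ≃ₘ⟮𝓡∂ 4, 𝓡∂ 4⟯ K.C)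
    (F : W₁ ≃ₘ⟮𝓡∂ 4, 𝓡∂ 4⟯ W₂) (χ : b.carrier ≃ₘ⟮𝓡 3, 𝓡 3⟯ b.carrier)
    (hΘκ : ∀ c, Θ (K.κ₁ c) = K.κ₂ (χc c)) (hΘι : ∀ w, Θ (K.ι₁ w) = K.ι₂ (F w))
    (hext : ∀ x, χc (K.bC.incl x) = K.bC.incl (K.j.symm (χ (K.j x)))) :
    ∀ y, e₂ (F (b.incl y)) = e₁ (b.incl (χ y)) := by
  intro y
  have h1 : K.ι₁ (b.incl y) = K.κ₁ (K.bC.incl (K.j.symm y)) := (K.glue₁ _ _).2 ⟨y, rfl, rfl⟩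
  have h2 : K.ι₂ (F (b.incl y)) = K.κ₂ (K.bC.incl (K.j.symm (χ y))) := by
    rw [← hΘι, h1, hΘκ, hext, Diffeomorph.apply_symm_apply]
  obtain ⟨z, hz, hc⟩ := (K.glue₂ _ _).1 h2
  have hzχ : χ y = z := K.j.symm.injective (K.bC.injective_incl hc)
  rw [hz, hzχ]

/-- **Re-parametrising a half: seam planes** (verbatim the chain-rule lemma of the sibling line
`AcyclicBisectionRigidity/Lines/minimal-factorisation-rigidity`). If `Φ : W₁ ≅ W₂` is a boundary
contactomorphism (`DΦ ξ₁ = ξ₂` on `∂W₁`) and the planes pushed forward by `e₁` and `e₂` agree on the seam, then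
so do the planes pushed forward by `e₁` and `e₂ ∘ Φ`, both read with `ξ₁`. [folklore] -/
theorem seamPlanes_comp_diffeomorph
    {M : Type} [TopologicalSpace M] [ChartedSpace (𝔼 4) M]
    {W₁ : Type} [TopologicalSpace W₁] [ChartedSpace (EuclideanHalfSpace 4) W₁] [IsManifold (𝓡∂ 4) ∞ W₁]
    {W₂ : Type} [TopologicalSpace W₂] [ChartedSpace (EuclideanHalfSpace 4) W₂] [IsManifold (𝓡∂ 4) ∞ W₂]
    (ξ₁ : W₁ → Submodule ℝ (𝔼 4)) (ξ₂ : W₂ → Submodule ℝ (𝔼 4)) {e₁ : W₁ → M} {e₂ : W₂ → M}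
    (he₂ : Manifold.IsSmoothEmbedding (𝓡∂ 4) (𝓡 4) ∞ e₂)
    (hseam₂ : range e₁ ∩ range e₂ = e₂ '' (𝓡∂ 4).boundary W₂)
    (hξ : ∀ w₁ w₂, e₁ w₁ = e₂ w₂ →
      Submodule.map (mfderiv (𝓡∂ 4) (𝓡 4) e₁ w₁).toLinearMap (ξ₁ w₁) =
      Submodule.map (mfderiv (𝓡∂ 4) (𝓡 4) e₂ w₂).toLinearMap (ξ₂ w₂))
    (Φ : W₁ ≃ₘ⟮𝓡∂ 4, 𝓡∂ 4⟯ W₂)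
    (hΦ : ∀ w, w ∈ (𝓡∂ 4).boundary W₁ →
      Submodule.map (mfderiv (𝓡∂ 4) (𝓡∂ 4) Φ w).toLinearMap (ξ₁ w) = ξ₂ (Φ w)) :
    ∀ w w', e₁ w = (e₂ ∘ Φ) w' →
      Submodule.map (mfderiv (𝓡∂ 4) (𝓡 4) e₁ w).toLinearMap (ξ₁ w) =
      Submodule.map (mfderiv (𝓡∂ 4) (𝓡 4) (e₂ ∘ Φ) w').toLinearMap (ξ₁ w') := by
  intro w w' h
  have hn : (∞ : WithTop ℕ∞) ≠ 0 := by simp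
  -- the matched point `Φ w'` is a boundary point of `W₂`, hence `w'` one of `W₁`
  have hmem : e₂ (Φ w') ∈ range e₁ ∩ range e₂ := ⟨⟨w, h⟩, ⟨Φ w', rfl⟩⟩
  rw [hseam₂] at hmem
  obtain ⟨v, hv, hve⟩ := hmem
  have hv' : v = Φ w' := he₂.isEmbedding.injective hve
  have hb₂ : Φ w' ∈ (𝓡∂ 4).boundary W₂ := hv' ▸ hv
  have hb₁ : w' ∈ (𝓡∂ 4).boundary W₁ := by
    have : w' ∈ Φ ⁻¹' (𝓡∂ 4).boundary W₂ := hb₂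
    rwa [Φ.preimage_boundary hn] at this
  -- chain rule
  have hd₂ : MDifferentiableAt (𝓡∂ 4) (𝓡 4) e₂ (Φ w') :=
    he₂.contMDiff.mdifferentiableAt (by simp)
  have hdΦ : MDifferentiableAt (𝓡∂ 4) (𝓡∂ 4) Φ w' := Φ.mdifferentiable (by simp) w'
  have hcomp : mfderiv (𝓡∂ 4) (𝓡 4) (e₂ ∘ Φ) w' =
      (mfderiv (𝓡∂ 4) (𝓡 4) e₂ (Φ w')).comp (mfderiv (𝓡∂ 4) (𝓡∂ 4) Φ w') :=
    mfderiv_comp w' hd₂ hdΦ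
  have key : Submodule.map (mfderiv (𝓡∂ 4) (𝓡 4) (e₂ ∘ Φ) w').toLinearMap (ξ₁ w') =
      Submodule.map (mfderiv (𝓡∂ 4) (𝓡 4) e₂ (Φ w')).toLinearMap
        (Submodule.map (mfderiv (𝓡∂ 4) (𝓡∂ 4) Φ w').toLinearMap (ξ₁ w')) := by
    rw [← Submodule.map_comp]
    congr 1
    rw [hcomp]
    rfl
  rw [key, hΦ w' hb₁]
  exact hξ w (Φ w') h

/-- **The composition: the five stubs prove the crux `ConvexBisection.PlanarBisectionRigidity` BY NAME.**
Unpack the planar bisection; Stub 1 gives a planar supporting open book `ob` on `b`, a common capping `K` and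
`Z₁ ≅ Z₂`; Stub 2a (if `W₁` is contractible) or Stub 2b (if not) upgrades it to a cap-preserving `Θ` with cap
automorphism `χ̂`, `F : W₁ ≅ W₂` and `χ`; `seamMismatch_of_capping` shows the seam mismatch of `F` is `χ`;
re-parametrising the second half by `e₂ ∘ F : W₁ → M` (a smooth embedding by the tree lemma
`Manifold.IsSmoothEmbedding.comp_diffeomorph`; same image; boundary to seam by `Diffeomorph.image_boundary`;
seam planes by `seamPlanes_comp_diffeomorph`) exhibits `M` as a cap-twisted double of `(W₁, J₁)`, and Stub 3
resp. Stub 4 recognises `S⁴`. -/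
theorem PlanarBisectionRigidity_of : PlanarBisectionRigidity := by
  intro M _ _ _ _ _ hM hb
  obtain ⟨W₁, _, _, _, _, W₂, _, _, _, _, J₁, J₂, e₁, e₂, he₁, he₂, hcover, hseam₁, hseam₂, hξ, hpl⟩ := hb
  obtain ⟨b, ob, hobpl, hsup, K, hZ⟩ :=
    stub_commonCap M hM W₁ W₂ J₁ J₂ e₁ e₂ he₁ he₂ hcover hseam₁ hseam₂ hξ hpl
  have hn : (∞ : WithTop ℕ∞) ≠ 0 := by simp
  -- the re-parametrisation bookkeeping, for any twin diffeomorphism `F`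
  have reparam : ∀ (F : W₁ ≃ₘ⟮𝓡∂ 4, 𝓡∂ 4⟯ W₂),
      (∀ w, w ∈ (𝓡∂ 4).boundary W₁ →
        Submodule.map (mfderiv (𝓡∂ 4) (𝓡∂ 4) F w).toLinearMap (contactPlane J₁.J w) =
          contactPlane J₂.J (F w)) →
      Manifold.IsSmoothEmbedding (𝓡∂ 4) (𝓡 4) ∞ (e₂ ∘ F) ∧
      range e₁ ∪ range (e₂ ∘ F) = univ ∧
      range e₁ ∩ range (e₂ ∘ F) = e₁ '' (𝓡∂ 4).boundary W₁ ∧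
      range e₁ ∩ range (e₂ ∘ F) = (e₂ ∘ F) '' (𝓡∂ 4).boundary W₁ ∧
      (∀ w w', e₁ w = (e₂ ∘ F) w' →
        Submodule.map (mfderiv (𝓡∂ 4) (𝓡 4) e₁ w).toLinearMap (contactPlane J₁.J w) =
        Submodule.map (mfderiv (𝓡∂ 4) (𝓡 4) (e₂ ∘ F) w').toLinearMap (contactPlane J₁.J w')) := by
    intro F hF
    have hsurj : Function.Surjective (F : W₁ → W₂) := fun y => ⟨F.symm y, F.apply_symm_apply y⟩
    have hrange : range (e₂ ∘ F) = range e₂ := by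
      rw [range_comp, hsurj.range_eq, image_univ]
    refine ⟨he₂.comp_diffeomorph F, ?_, ?_, ?_, ?_⟩
    · rw [hrange]; exact hcover
    · rw [hrange]; exact hseam₁
    · rw [hrange, image_comp, F.image_boundary hn]; exact hseam₂
    · exact seamPlanes_comp_diffeomorph (fun w => contactPlane J₁.J w) (fun w => contactPlane J₂.J w)
        he₂ hseam₂ hξ F hF
  by_cases hW : ContractibleSpace W₁
  · obtain ⟨Θ, χc, F, χ, hΘκ, hΘι, hext, hF⟩ := stub_capUniqueness M hM W₁ W₂ J₁ J₂ e₁ e₂ he₁ he₂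
      hcover hseam₁ hseam₂ hξ b ob hobpl hsup K hZ hW
    have hχ : ∀ y, (e₂ ∘ F) (b.incl y) = e₁ (b.incl (χ y)) :=
      seamMismatch_of_capping K Θ χc F χ hΘκ hΘι hext
    obtain ⟨he₂', hcover', hseam₁', hseam₂', hξ'⟩ := reparam F hF
    exact stub_capTwistedDouble M hM W₁ J₁ b ob hobpl hsup e₁ (e₂ ∘ F) he₁ he₂' hcover' hseam₁' hseam₂'
      hξ' χ hχ K.C K.bC K.j K.isCap χc hext
  · obtain ⟨Θ, χc, F, χ, hΘκ, hΘι, hext, hF⟩ := stub_capUniquenessTorsion M hM W₁ W₂ J₁ J₂ e₁ e₂ he₁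
      he₂ hcover hseam₁ hseam₂ hξ b ob hobpl hsup K hZ hW
    have hχ : ∀ y, (e₂ ∘ F) (b.incl y) = e₁ (b.incl (χ y)) :=
      seamMismatch_of_capping K Θ χc F χ hΘκ hΘι hext
    obtain ⟨he₂', hcover', hseam₁', hseam₂', hξ'⟩ := reparam F hF
    exact stub_capTwistedDoubleTorsion M hM W₁ hW J₁ b ob hobpl hsup e₁ (e₂ ∘ F) he₁ he₂' hcover'
      hseam₁' hseam₂' hξ' χ hχ K.C K.bC K.j K.isCap χc hext

/-! ## Cross-links (sorry-free) -/

/-- **Stub 3 is implied by the route's rank-4 crux `ContractibleTwistedDoubleStandard`** (take `X = M`,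
compact by the PROVED tree fact `compactSpace_of_homotopyEquiv_sphere_four_holds`, `W₁ = W₂ = W`,
`J₁ = J₂ = J`; the cap data are simply forgotten): the contractible residual of this line is already staffed
as crux 4, and this line's statement is WEAKER (planar seam, one body, cap-extendable contactomorphism). -/
theorem capTwistedDouble_of_crux4 (h4 : ContractibleTwistedDoubleStandard)
    (M : Type) [TopologicalSpace M] [T2Space M] [SecondCountableTopology M] [ChartedSpace (𝔼 4) M]
    [IsManifold (𝓡 4) ∞ M] (hM : M ≃ₕ 𝕊⁴)
    (W : Type) [TopologicalSpace W] [ChartedSpace (EuclideanHalfSpace 4) W] [IsManifold (𝓡∂ 4) ∞ W]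
    [CompactSpace W] [ContractibleSpace W] (J : SteinStructure W)
    (b : BoundaryData (𝓡∂ 4) W (𝓡 3)) (ob : OpenBook b.carrier) (hobpl : ob.IsPlanar)
    (hsup : ob.Supports (boundaryPlaneField J.J b))
    (e₁ e₂ : W → M)
    (he₁ : Manifold.IsSmoothEmbedding (𝓡∂ 4) (𝓡 4) ∞ e₁)
    (he₂ : Manifold.IsSmoothEmbedding (𝓡∂ 4) (𝓡 4) ∞ e₂)
    (hcover : range e₁ ∪ range e₂ = univ)
    (hseam₁ : range e₁ ∩ range e₂ = e₁ '' (𝓡∂ 4).boundary W)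
    (hseam₂ : range e₁ ∩ range e₂ = e₂ '' (𝓡∂ 4).boundary W)
    (hξ : ∀ w w', e₁ w = e₂ w' →
      Submodule.map (mfderiv (𝓡∂ 4) (𝓡 4) e₁ w).toLinearMap (contactPlane J.J w) =
      Submodule.map (mfderiv (𝓡∂ 4) (𝓡 4) e₂ w').toLinearMap (contactPlane J.J w'))
    (χ : b.carrier ≃ₘ⟮𝓡 3, 𝓡 3⟯ b.carrier) (hχ : ∀ y, e₂ (b.incl y) = e₁ (b.incl (χ y)))
    (C : Type) [TopologicalSpace C] [T2Space C] [SecondCountableTopology C]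
    [ChartedSpace (EuclideanHalfSpace 4) C] [IsManifold (𝓡∂ 4) ∞ C] [CompactSpace C]
    (bC : BoundaryData (𝓡∂ 4) C (𝓡 3)) (j : bC.carrier ≃ₘ⟮𝓡 3, 𝓡 3⟯ b.carrier)
    (hcap : IsPlanarCap ob bC j) (χc : C ≃ₘ⟮𝓡∂ 4, 𝓡∂ 4⟯ C)
    (hext : ∀ x, χc (bC.incl x) = bC.incl (j.symm (χ (j x)))) :
    Nonempty (M ≃ₘ⟮𝓡 4, 𝓡 4⟯ 𝕊⁴) := by
  haveI : CompactSpace M :=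
    Literature.Topology.FourManifolds.compactSpace_of_homotopyEquiv_sphere_four_holds M hM
  exact h4 M W W J J e₁ e₂ he₁ he₂ hcover hseam₁ hseam₂ hξ

/-- **The falsifiable shadow of the lever: planar homotopy-sphere twins are diffeomorphic** (Stubs 1 + 2a/2b
⇒ `W₁ ≅ W₂` for every planar common-contact Stein bisection of a homotopy 4-sphere). NOT implied by SPC4 —
this is where a refuter without an exotic sphere aims (sibling Disproof §6; triage r1-2/r1-3 on
Akbulut–Yildiz / HMP pairs). -/
theorem planarCapTwins_of_stubs
    (M : Type) [TopologicalSpace M] [T2Space M] [SecondCountableTopology M] [ChartedSpace (𝔼 4) M]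
    [IsManifold (𝓡 4) ∞ M] (hM : M ≃ₕ 𝕊⁴)
    (W₁ : Type) [TopologicalSpace W₁] [ChartedSpace (EuclideanHalfSpace 4) W₁] [IsManifold (𝓡∂ 4) ∞ W₁]
    [CompactSpace W₁] (W₂ : Type) [TopologicalSpace W₂] [ChartedSpace (EuclideanHalfSpace 4) W₂]
    [IsManifold (𝓡∂ 4) ∞ W₂] [CompactSpace W₂] (J₁ : SteinStructure W₁) (J₂ : SteinStructure W₂)
    (e₁ : W₁ → M) (e₂ : W₂ → M)
    (he₁ : Manifold.IsSmoothEmbedding (𝓡∂ 4) (𝓡 4) ∞ e₁)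
    (he₂ : Manifold.IsSmoothEmbedding (𝓡∂ 4) (𝓡 4) ∞ e₂)
    (hcover : range e₁ ∪ range e₂ = univ)
    (hseam₁ : range e₁ ∩ range e₂ = e₁ '' (𝓡∂ 4).boundary W₁)
    (hseam₂ : range e₁ ∩ range e₂ = e₂ '' (𝓡∂ 4).boundary W₂)
    (hξ : ∀ w₁ w₂, e₁ w₁ = e₂ w₂ →
      Submodule.map (mfderiv (𝓡∂ 4) (𝓡 4) e₁ w₁).toLinearMap (contactPlane J₁.J w₁) =
      Submodule.map (mfderiv (𝓡∂ 4) (𝓡 4) e₂ w₂).toLinearMap (contactPlane J₂.J w₂))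
    (hpl : PlanarContactBoundary J₁) :
    Nonempty (W₁ ≃ₘ⟮𝓡∂ 4, 𝓡∂ 4⟯ W₂) := by
  obtain ⟨b, ob, hobpl, hsup, K, hZ⟩ :=
    stub_commonCap M hM W₁ W₂ J₁ J₂ e₁ e₂ he₁ he₂ hcover hseam₁ hseam₂ hξ hpl
  by_cases hW : ContractibleSpace W₁
  · obtain ⟨-, -, F, -⟩ := stub_capUniqueness M hM W₁ W₂ J₁ J₂ e₁ e₂ he₁ he₂ hcover hseam₁ hseam₂ hξ
      b ob hobpl hsup K hZ hW
    exact ⟨F⟩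
  · obtain ⟨-, -, F, -⟩ := stub_capUniquenessTorsion M hM W₁ W₂ J₁ J₂ e₁ e₂ he₁ he₂ hcover hseam₁
      hseam₂ hξ b ob hobpl hsup K hZ hW
    exact ⟨F⟩

/-! ## Sanity: the crux decl is in scope and the cap predicate is a `Prop`. -/
example : Prop := PlanarBisectionRigidity
example : PlanarBisectionRigidity := PlanarBisectionRigidity_of

end Summit.SmoothPoincare4.SmoothPoincare4.Cruxes.PlanarBisectionRigidity.OneCapTwoFillings

end
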